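import Literature.Computability.Complexity.GraphCanonizationRefiner
import Summits.PneNP.PneNP.Theorems.SymmetryBudgetWindowCanoniserSemBasic

/-!
# Window canoniser, XII: the replay of a label, mathematically (definitions)

Route `PneNP/SymmetryBudget`, dichotomy `WindowBarrier` (stmt-PneNP-2145) / `NoHiddenOrder` (stmt-PneNP-14781);
continuation of `…WindowCanoniserSemBasic.lean`.  The REPLAY of a label `L = (U, X, λ)` on the window graph
`G x`, as a deterministic iteration on states `WCan.St` = (vertex set `W`, colouring `c`, consumed vertices `C`,
flags `arr`/`dead`) over the Corneil–Goldberg process of the tree (`Literature.…CGCanon`: `crRefine`,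
`bigMinCell`, `IsConn`, `swG`, `individualize`):

* start at `(univ, crRefine G univ 0, ∅)`;
* an iteration FREEZES if arrived (`W = U ∧ C = X` now or earlier) or dead; otherwise it DIES on `|W| ≤ 1`;
  at a CONNECTED state it individualises the selected vertex — the unique `λ`-maximal vertex of
  `bigMinCell W c ∩ (X ∖ C)` (`WCan.selSet`) — refines (`crRefine`) and consumes it (dying if there is none);
  at a disconnected state it moves to the union of the switched-graph components meeting `U` if that is ONE
  component (`WCan.pokP`), else dies.
All next-state components are given by total formulas (`WCan.step`), exactly as the gates compute them (also on
dead states, whose contents are irrelevant).  `WCan.rs L x it` is the state after `it` iterations;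
`WCan.liftLT` the strict colour order of a state lifted off `W` (`CGCanon.liftCol`), which is what the `LT`
gates hold.  The correspondence with the gates is `…SemReplay*.lean`.
-/

-- `Summit.PneNP.PneNP.…` duplicates `PneNP` BY DESIGN (single-problem summit, D-0017 layout).
set_option linter.dupNamespace false

noncomputable section

namespace Summit.PneNP.PneNP.Theorems

namespace WCan

open Finset Literature.Computability.Complexity Literature.Computability.Complexity.CGCanon
  Literature.Computability.Complexity.ColourRefinementScheme
open scoped Classical

variable {r n : ℕ}

/-- A replay STATE: vertex set, colouring (read on `W`), consumed vertices, arrived flag, dead flag. -/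
structure St (n : ℕ) where
  /-- current vertex set -/
  W : Finset (Fin n)
  /-- current colouring -/
  c : Fin n → ℕ
  /-- consumed (individualised) vertices -/
  C : Finset (Fin n)
  /-- arrived at the label's node (frozen) -/
  arr : Bool
  /-- the replay failed -/
  dead : Bool

namespace St

variable (S : St n)

/-- The strict colour order LIFTED off `W`: vertices outside `W` come first, inside `W` by colour
(the order of `CGCanon.liftCol W c`). -/
def liftLT (u w : Fin n) : Prop := (u ∉ S.W ∧ w ∈ S.W) ∨ (u ∈ S.W ∧ w ∈ S.W ∧ S.c u < S.c w)

/-- `liftLT` is the order of the lifted colouring. -/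
theorem liftLT_iff (u w : Fin n) : S.liftLT u w ↔ liftCol S.W S.c u < liftCol S.W S.c w := by
  unfold liftLT
  by_cases hu : u ∈ S.W <;> by_cases hw : w ∈ S.W <;> simp [hu, hw, liftCol]

/-- Inside `W`, `liftLT` is the colour order. -/
theorem liftLT_of_mem {u w : Fin n} (hu : u ∈ S.W) (hw : w ∈ S.W) : S.liftLT u w ↔ S.c u < S.c w := by
  simp [liftLT, hu, hw]

/-- Equal lifted colours: neither is below the other. -/
theorem not_liftLT_iff {u w : Fin n} : (¬ S.liftLT u w ∧ ¬ S.liftLT w u) ↔ liftCol S.W S.c u = liftCol S.W S.c w := by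
  rw [liftLT_iff, liftLT_iff]; omega

end St

section Replay

variable (L : RawLab n) (x : Fin (r + n) × Fin (r + n) → Bool)

/-- The replay has ARRIVED NOW: the state's sets are the label's. -/
def nowP (S : St n) : Prop := S.W = L.U ∧ S.C = L.X

/-- The state is FROZEN: arrived earlier, now, or dead. -/
def frzP (S : St n) : Prop := S.arr = true ∨ nowP L S ∨ S.dead = true

/-- The SELECTED vertices: `λ`-maxima of `bigMinCell W c ∩ (X ∖ C)` strictly above all other members
(at most one vertex). -/
def selSet (S : St n) : Finset (Fin n) :=
  (bigMinCell S.W S.c ∩ (L.X \ S.C)).filter fun v => ∀ w ∈ bigMinCell S.W S.c ∩ (L.X \ S.C), w ≠ v → L.lam w < L.lam v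

/-- The section move is possible: `U` is nonempty, inside `W`, and lies in one switched-graph component. -/
def pokP (S : St n) : Prop :=
  (∀ u ∈ L.U, ∀ u' ∈ L.U, u ∈ S.W ∧ (swG (G x) S.W S.c).Reachable u u') ∧ L.U.Nonempty

/-- The new vertex set after a section move: the vertices of `W` reachable from `U ∩ W`. -/
def secW (S : St n) : Finset (Fin n) := S.W.filter fun v => ∃ u ∈ L.U, u ∈ S.W ∧ (swG (G x) S.W S.c).Reachable u v

/-- The colouring to be refined at an individualisation step: `c` with the selected vertex individualised
(just `c` if none is selected). -/
def indCol (S : St n) : Fin n → ℕ :=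
  if h : (selSet L S).Nonempty then individualize S.c ((selSet L S).min' h) else S.c

/-- **One replay iteration** (total formulas for every component; see the module docstring). -/
def step (S : St n) : St n :=
  let frz := frzP L S
  let conn := IsConn (G x) S.W S.c
  { W := if frz then S.W else if conn then S.W else secW L x S
    c := if frz then S.c else if conn then crRefine (G x) S.W (indCol L S) else S.c
    C := if frz then S.C else if conn then S.C ∪ selSet L S else S.C
    arr := S.arr || decide (nowP L S)
    dead := S.dead || decide (¬ frz ∧ (S.W.card ≤ 1 ∨ (conn ∧ ¬ (selSet L S).Nonempty) ∨ (¬ conn ∧ ¬ pokP L x S))) }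

/-- The initial state: all window vertices, the refined constant colouring, nothing consumed. -/
def initSt (x : Fin (r + n) × Fin (r + n) → Bool) : St n := ⟨univ, crRefine (G x) univ (fun _ => 0), ∅, false, false⟩

/-- **The state after `it` iterations.** -/
def rs (it : ℕ) : St n := (step L x)^[it] (initSt x)

/-- Unfolding `rs` at `0`. -/
@[simp] theorem rs_zero : rs L x 0 = initSt x := rfl

/-- Unfolding `rs` at a successor. -/
theorem rs_succ (it : ℕ) : rs L x (it + 1) = step L x (rs L x it) := by
  rw [rs, Function.iterate_succ_apply']; rfl

/-- The replay is OK: arrived and not dead after `T n` iterations. -/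
def okP : Prop := (rs L x (T n)).arr = true ∧ (rs L x (T n)).dead = false

/-! ### Basic facts about selection and freezing -/

/-- At most one vertex is selected. -/
theorem card_selSet_le_one (S : St n) : (selSet L S).card ≤ 1 := by
  refine card_le_one.2 fun v hv w hw => ?_
  by_contra hne
  rw [selSet, mem_filter] at hv hw
  have h1 := hv.2 w hw.1 (Ne.symm hne)
  have h2 := hw.2 v hv.1 hne
  exact lt_asymm h1 h2

/-- Membership in `selSet`. -/
theorem mem_selSet {S : St n} {v : Fin n} : v ∈ selSet L S ↔ v ∈ bigMinCell S.W S.c ∧ v ∈ L.X ∧ v ∉ S.C ∧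
    ∀ w, w ∈ bigMinCell S.W S.c → w ∈ L.X → w ∉ S.C → w ≠ v → L.lam w < L.lam v := by
  simp only [selSet, mem_filter, mem_inter, mem_sdiff]
  constructor
  · rintro ⟨⟨h1, h2, h3⟩, h4⟩; exact ⟨h1, h2, h3, fun w a b c d => h4 w ⟨a, b, c⟩ d⟩
  · rintro ⟨h1, h2, h3, h4⟩; exact ⟨⟨h1, h2, h3⟩, fun w hw hne => h4 w hw.1 hw.2.1 hw.2.2 hne⟩

/-- If `v` is selected, `selSet = {v}`. -/
theorem selSet_eq_singleton {S : St n} {v : Fin n} (hv : v ∈ selSet L S) : selSet L S = {v} :=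
  eq_singleton_iff_unique_mem.2 ⟨hv, fun w hw => card_le_one.1 (card_selSet_le_one L S) w hw v hv⟩

/-- If `v` is selected, the refined colouring individualises `v`. -/
theorem indCol_of_mem {S : St n} {v : Fin n} (hv : v ∈ selSet L S) : indCol L S = individualize S.c v := by
  unfold indCol
  have hne : (selSet L S).Nonempty := ⟨v, hv⟩
  rw [dif_pos hne]
  congr 1
  have := selSet_eq_singleton L hv
  simp [this]

/-- With nothing selected, the refined colouring is `c`. -/
theorem indCol_of_empty {S : St n} (h : selSet L S = ∅) : indCol L S = S.c := by
  unfold indCol; rw [dif_neg (by simp [h])]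

/-- A frozen state keeps its sets and colouring, and stays frozen. -/
theorem step_of_frz {S : St n} (h : frzP L S) :
    (step L x S).W = S.W ∧ (step L x S).c = S.c ∧ (step L x S).C = S.C ∧ (step L x S).dead = S.dead ∧ frzP L (step L x S) := by
  have hd : (step L x S).dead = S.dead := by
    cases hS : S.dead <;> simp [step, h, hS]
  refine ⟨by simp [step, h], by simp [step, h], by simp [step, h], hd, ?_⟩
  rcases h with h | h | h
  · left; simp [step, h]
  · left; simp [step, h]
  · right; right; rw [hd, h]

end Replay

end WCan

end Summit.PneNP.PneNP.Theorems

end
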